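import Summits.NavierStokesRegularity.NavierStokesRegularity.Theorems.PerpetualPumpEulerTypeIGlueFourierL2
import Summits.NavierStokesRegularity.NavierStokesRegularity.Theorems.PerpetualPumpEulerTypeIGlueDuhamel
import Literature.Analysis.FluidPDE.KNSSTypeIIHolds
import Literature.Analysis.FluidPDE.NSWave0

/-!
# Route PerpetualPump · `EulerTypeIGlue` — stub `stub_backEnd` (line `Sketch`)

The back end (card `h10-continuity-certificate`) of the line: a curve `v : [0,T') → L²(ℝ³; ℂ³)`
with finite `H¹⁰` norms, `H¹⁰`-continuous on `[0,T')`, `T' > bT`, whose slices `v (b t)`,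
`t ∈ [0,T)`, agree a.e. with `a • (u t)^ℂ` (`a, b > 0`), certifies that the classical Leray–Hopf
solution `u` is bounded on `[0,T) × ℝ³`, hence extends classically past `T`. The curve `v` is
never upgraded to a classical solution; it is only a boundedness certificate:

* the compact interval `[0, bT] ⊂ [0, T')` carries a uniform `H¹⁰` bound for `v`
  (`Tao2016.ContinuousInH10On.exists_bound`: the real-valued `H¹⁰` norm is continuous on it);
* `H¹⁰(ℝ³) ⊂ L^∞` quantitatively (`eLpNorm_top_le_sobolevTen`, toolkit I) turns it into an
  essential bound for `a • (u t)^ℂ`, i.e. an a.e. bound `‖u t x‖ ≤ R` for every `t ∈ [0,T)`;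
* continuity of the classical slices `u t` upgrades a.e. to everywhere (open sets have positive
  Lebesgue measure);
* Robinson–Rodrigo–Sadowski 2016, Thm. 8.17 (`hasSmoothExtensionPast_of_bounded_holds`, PROVED in
  the tree) continues the bounded Leray–Hopf solution past `T`.

## References

* J. C. Robinson, J. L. Rodrigo, W. Sadowski, *The Three-Dimensional Navier–Stokes Equations*,
  CUP (2016), Thm. 8.17 (r = 2, s = ∞) with Thms. 6.15, 6.10, 7.5. [RobinsonRodrigoSadowski2016]
* T. Tao, J. Amer. Math. Soc. 29 (2016), arXiv:1402.0290v3, §1.1 (1.15) (continuity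
  `u : I → H¹⁰_df` within `I`; `H¹⁰ ⊂ 𝓕L¹ ⊂ L^∞`, p. 3). [Tao2016AveragedNS]
-/

noncomputable section

open MeasureTheory Set Filter Topology FourierTransform
open scoped ENNReal NNReal RealInnerProductSpace SchwartzMap ContDiff

set_option linter.dupNamespace false

namespace Summit.NavierStokesRegularity.NavierStokesRegularity.Theorems.PerpetualPumpEulerTypeIGlue

open Literature.Analysis.FluidPDE Literature.Analysis.FluidPDE.Tao2016
open Literature.Analysis.FunctionSpaces (eFourierSobolevNorm)
open Literature.Analysis.FunctionSpaces.EuclideanSpace (complexify complexify_apply norm_complexify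
  continuous_complexify)

/-- Local notation for physical / frequency space `ℝ³`. -/
local notation "ℝ³" => EuclideanSpace ℝ (Fin 3)
/-- Local notation for the complexified range `ℂ³`. -/
local notation "ℂ³" => EuclideanSpace ℂ (Fin 3)

/-- A continuous field `f : ℝ³ → ℝ³` with `‖f x‖ ≤ R` for a.e. `x` obeys the bound everywhere:
the open set `{R < ‖f‖}` is Lebesgue-null, hence empty. [folklore] -/
theorem forall_norm_le_of_ae_norm_le {f : ℝ³ → ℝ³} (hf : Continuous f) {R : ℝ}
    (h : ∀ᵐ x ∂(volume : Measure ℝ³), ‖f x‖ ≤ R) : ∀ x, ‖f x‖ ≤ R := by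
  intro x
  by_contra hx
  rw [not_le] at hx
  have hopen : IsOpen {y : ℝ³ | R < ‖f y‖} := isOpen_lt continuous_const hf.norm
  have hpos : 0 < volume {y : ℝ³ | R < ‖f y‖} := hopen.measure_pos volume ⟨x, hx⟩
  have hzero : volume {y : ℝ³ | R < ‖f y‖} = 0 := by
    rw [ae_iff] at h
    simpa only [not_le] using h
  exact hpos.ne' hzero

/-- An essential bound `‖a • f^ℂ‖_{L^∞} ≤ C < ∞` with `a > 0` gives `‖f x‖ ≤ C.toReal / a` for
a.e. `x` (`‖a • y^ℂ‖ = a ‖y‖`, `norm_complexify`). [folklore] -/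
theorem ae_norm_le_of_eLpNorm_smul_complexify_le {f : ℝ³ → ℝ³} {a : ℝ} (ha : 0 < a) {C : ℝ≥0∞}
    (hC : C ≠ ⊤)
    (h : eLpNorm (fun x => ((a : ℝ) : ℂ) • complexify (f x)) ⊤ (volume : Measure ℝ³) ≤ C) :
    ∀ᵐ x ∂(volume : Measure ℝ³), ‖f x‖ ≤ C.toReal / a := by
  rw [eLpNorm_exponent_top] at h
  filter_upwards [ae_le_eLpNormEssSup (μ := (volume : Measure ℝ³))
    (f := fun x => ((a : ℝ) : ℂ) • complexify (f x))] with x hx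
  have hx' : ‖((a : ℝ) : ℂ) • complexify (f x)‖ₑ ≤ C := hx.trans h
  have hnorm : ‖((a : ℝ) : ℂ) • complexify (f x)‖ = a * ‖f x‖ := by
    rw [norm_smul, Complex.norm_real, Real.norm_of_nonneg ha.le, norm_complexify]
  have hreal := ENNReal.toReal_mono hC hx'
  rw [toReal_enorm, hnorm] at hreal
  rw [le_div_iff₀ ha, mul_comm]
  exact hreal

/-- **S7 — the back end (card `h10-continuity-certificate`)**: a mild `H¹⁰_df` curve `v` on `[0,T')`,
`T' > bT`, whose slices `v (b t)`, `t ∈ [0,T)`, are `a • (u t)^ℂ` (`a, b > 0`), certifies that the classical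
Leray–Hopf solution `u` is bounded on `[0,T) × ℝ³` (uniform `H¹⁰` bound for `v` on the compact
`[0, bT] ⊂ [0,T')` by `H¹⁰`-continuity, then `H¹⁰ ⊂ L^∞` and continuity of the slices), hence extends
classically past `T` (`hasSmoothExtensionPast_of_bounded_holds`, Robinson–Rodrigo–Sadowski 2016 Thm. 8.17).
[cite: RobinsonRodrigoSadowski2016, Thm 8.17 with Thms 6.15, 6.10, 7.5] -/
theorem stub_backEnd {ν T T' a b : ℝ} (hν : 0 < ν) (hT : 0 < T) (ha : 0 < a) (hb : 0 < b)
    (hbT : b * T < T') {u : ℝ → ℝ³ → ℝ³} {p : ℝ → ℝ³ → ℝ}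
    (hcl : IsClassicalNSSolutionOn (Ico 0 T) ν 0 u p) (hLH : IsLerayHopfOn T ν 0 (u 0) u)
    (hdec : HasRapidSpatialDecay (u 0)) (v : ℝ → L2C)
    (hvH : ∀ s ∈ Ico 0 T', MemH10df (v s)) (hvc : ContinuousInH10On (Ico 0 T') v)
    (hagree : ∀ t ∈ Ico 0 T, ((v (b * t) : L2C) : ℝ³ → ℂ³) =ᵐ[volume]
      fun x => ((a : ℝ) : ℂ) • complexify (u t x)) :
    HasSmoothExtensionPast ν 0 u T := by
  have _h := hdec
  -- (1) a uniform `H¹⁰` bound for `v` on the compact interval `[0, bT] ⊂ [0, T')`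
  have hsub : Icc 0 (b * T) ⊆ Ico 0 T' := fun s hs => ⟨hs.1, hs.2.trans_lt hbT⟩
  have hfin : ∀ s ∈ Icc 0 (b * T), eFourierSobolevNorm 10 (v s) < ⊤ := fun s hs =>
    (hvH s (hsub hs)).1
  obtain ⟨M, hM⟩ := (hvc.mono hsub).exists_bound hfin
  -- (2) the `H¹⁰ ⊂ L^∞` constant and the resulting essential bound
  set K : ℝ≥0∞ := (∫⁻ ξ : ℝ³, ENNReal.ofReal ((1 + ‖ξ‖ ^ 2) ^ (-10 : ℝ))) ^ (1 / 2 : ℝ) with hK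
  have hCtop : K * ENNReal.ofReal M ≠ ⊤ := ENNReal.mul_ne_top sobolevTen_const_lt_top.ne
    ENNReal.ofReal_ne_top
  refine hasSmoothExtensionPast_of_bounded_holds hν hT hcl hLH
    ⟨(K * ENNReal.ofReal M).toReal / a, fun t ht x => ?_⟩
  have hbt : b * t ∈ Icc 0 (b * T) :=
    ⟨mul_nonneg hb.le ht.1, mul_le_mul_of_nonneg_left ht.2.le hb.le⟩
  have hH10 : eFourierSobolevNorm 10 (v (b * t)) ≤ ENNReal.ofReal M := by
    rw [← ENNReal.ofReal_toReal (hfin _ hbt).ne]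
    exact ENNReal.ofReal_le_ofReal (hM _ hbt)
  have hLinf : eLpNorm (fun x => ((a : ℝ) : ℂ) • complexify (u t x)) ⊤ (volume : Measure ℝ³) ≤
      K * ENNReal.ofReal M := by
    rw [← eLpNorm_congr_ae (hagree t ht)]
    exact (eLpNorm_top_le_sobolevTen (v (b * t))).trans (by gcongr)
  -- (3) a.e. bound, upgraded to a pointwise bound by continuity of the classical slice `u t`
  exact forall_norm_le_of_ae_norm_le (hcl.contDiff_velocity ht).continuous
    (ae_norm_le_of_eLpNorm_smul_complexify_le ha hCtop hLinf) x

end Summit.NavierStokesRegularity.NavierStokesRegularity.Theorems.PerpetualPumpEulerTypeIGlue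

end
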